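import Summits.Ventures.YMGap.Thresholds.StarWindowBoundSUN
import Summits.Ventures.YMGap.Thresholds.StarFrontTorus
import Summits.Ventures.YMGap.Thresholds.StarLemmaGRows
import Literature.MathematicalPhysics.QuantumFieldTheory.Balaban1983to89.StrongCouplingKernelWindow
import HarnessLib

/-!
# Venture YMGap — track (c) «DS»: the generic-`N` star door for bounded measurable local observables on one
# torus (DLR smoothing) — `SU(N)`, `d = 4`, first half of the currency adapter

HONEST FRAMING: venture file (cell `pub-ymgap`), strong-coupling LATTICE bookkeeping for `SU(N)` lattice
Yang–Mills on the torus `(ℤ/L)^4`, Wilson plaquette weight `exp(−β (N − Re tr U_q))`, tree coupling `β`;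
nothing about the continuum, confinement at weak coupling, or the mass gap.  `SU(N)` twin of ds-1's
`StarFrontTorus.su2Star_abs_integral_mul_sub_le` (typed for `SU(2)` and the schema `StarWindowBound`): the
INPUT is a vertex-indexed influence array for the star windows of the `SU(N)` torus Wilson specification
(nonnegative, supported within sup-distance `1` of the centre, the window contraction (H1), per-star received
sums `≤ ρ < 1`) — supplied for every `N` by `StarLemmaGSUN.star_window_of_oneLinkKRModulus`; the OUTPUT is
the covariance bound for bounded measurable observables of disjoint link sets by Föllmer smoothing
(`specAvg`, `isLipBound_specAvg_torusWeightSpec`) and the star door `DSWindow.star_abs_covariance_le`,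
with prefactor `4(2√N)²` and smoothing factor `wilsonSmoothLip N 4 β`.  The volume-uniform clustering and
the ledger currency (`ExponentialClustering`, `StrongCouplingFront`) are the sibling `StarFrontSUN.lean`.
-/

noncomputable section

open MeasureTheory ProbabilityTheory Function Finset
open Literature.Probability.LatticeModels
open Literature.Probability.LatticeModels.DobrushinMetric
open Literature.MathematicalPhysics.QuantumLattice (toTorusObservable IsCylinder IsLocalObservable
  LGConfig torusLift torusEdge groupHeatKernelMeasure fundamentalRep fundamentalLatticeRep)
open Literature.MathematicalPhysics.QuantumFieldTheory
open Literature.MathematicalPhysics.QuantumFieldTheory.Balaban1983to89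
open Literature.MathematicalPhysics.QuantumFieldTheory.Balaban1983to89.StrongCouplingTorusWindow
open Literature.MathematicalPhysics.QuantumFieldTheory.Balaban1983to89.StrongCouplingDobrushinWindow
  (OneLinkKRModulus)
open Literature.MathematicalPhysics.QuantumFieldTheory.Balaban1983to89.StrongCouplingKernelWindow
  (oneLinkKRModulus_SU)
open Summit.Ventures.YMGap.DSWindow
open Summit.Ventures.YMGap.StarWindowGauge (gaugeR Delta_pos gaugeR_lt_one_of_le)
open Summit.Ventures.YMGap.StarLemmaG (Karr gaugeR_nonneg)
open Summit.Ventures.YMGap.StarLemmaGSUN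

namespace Summit.Ventures.YMGap.StarSUNFront

variable {L : ℕ} [NeZero L] {N : ℕ}

omit [NeZero L] in
/-- `0 ≤ R_G(4c)` for `0 ≤ c`, `4c ≤ 7/10`. [folklore] -/
theorem gaugeR_coef_nonneg {c : ℝ} (hc0 : 0 ≤ c) (hc7 : 4 * c ≤ 7 / 10) : 0 ≤ gaugeR (4 * c) :=
  gaugeR_nonneg (by linarith) hc7

/-! ### One torus: DLR smoothing + the generic star door -/

/-- **Covariance bound on one torus by DLR smoothing and the star door** (`SU(N)`, `d = 4`, tree coupling
`β`, torus side `L ≥ 2`): given a vertex-indexed influence array `K ≥ 0`, supported on boundary links within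
periodic sup-distance `1` of the centre, satisfying (H1) for the star windows of the `SU(N)` torus Wilson
specification and per-star received sums `≤ ρ < 1`, bounded measurable `f, g` depending on link sets
`Δf, Δg` with `plaqClosure Δf` disjoint from `Δg` and endpoints of `plaqClosure Δf`, `plaqClosure Δg` at
periodic sup-distance `≥ L₀` satisfy
`|μ(fg) − μ(f)μ(g)| ≤ 4 (2√N)² e^{−κ(ρ) L₀} (#plaqClosure Δf · M_f E)(#plaqClosure Δg · M_g E)`,
`E = wilsonSmoothLip N 4 β` (Föllmer 1988 Ch. I Thm. (2.13) route: smooth by `γ_{Δf}`, `γ_{Δg}`, then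
`DSWindow.star_abs_covariance_le`).  Port of `su2Star_abs_integral_mul_sub_le`. [folklore] -/
theorem star_abs_integral_mul_sub_le (hL : 1 < L) (hN : 1 ≤ N) (β : ℝ) {ρ : ℝ} (hρ0 : 0 ≤ ρ) (hρ1 : ρ < 1)
    {K : Site 4 L → Edge 4 L → Edge 4 L → ℝ} (hK : ∀ s y x, 0 ≤ K s y x)
    (hKloc : ∀ s y x, K s y x ≠ 0 → ∀ w ∈ linkEnds y, torusNorm (s - w) ≤ 1)
    (hH1 : IsLinkWindowContraction (d := 4) (L := L) (wilsonPlaqWeight N β) suFrobDist starWin fun c => K c.1)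
    (hsum : ∀ (s : Site 4 L) (x : Edge 4 L), x ∈ vertexStar s → ∑ y, K s y x ≤ ρ)
    {f g : GaugeConfig 4 L (Matrix.specialUnitaryGroup (Fin N) ℂ) → ℝ} (hfm : Measurable f)
    {Δf : Finset (Edge 4 L)} (hfdep : DependsOn f (↑Δf : Set (Edge 4 L))) {Mf : ℝ}
    (hMf : ∀ σ, |f σ| ≤ Mf) (hgm : Measurable g) {Δg : Finset (Edge 4 L)}
    (hgdep : DependsOn g (↑Δg : Set (Edge 4 L))) {Mg : ℝ} (hMg : ∀ σ, |g σ| ≤ Mg)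
    (hsep : ∀ y ∈ plaqClosure Δf, y ∉ Δg) (L₀ : ℕ)
    (hL₀ : ∀ y ∈ plaqClosure Δf, ∀ z ∈ plaqClosure Δg, ∀ a ∈ linkEnds y, ∀ w ∈ linkEnds z,
      L₀ ≤ torusNorm (a - w)) :
    |(∫ σ, f σ * g σ ∂(wilsonMeasure (d := 4) (L := L) (fundamentalRep (Fin N)) β)) -
        (∫ σ, f σ ∂(wilsonMeasure (d := 4) (L := L) (fundamentalRep (Fin N)) β)) *
          ∫ σ, g σ ∂(wilsonMeasure (d := 4) (L := L) (fundamentalRep (Fin N)) β)| ≤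
      4 * (2 * Real.sqrt N) ^ 2 * Real.exp (-(starRate ρ * L₀)) *
        ((plaqClosure Δf).card * (Mf * wilsonSmoothLip N 4 β)) *
        ((plaqClosure Δg).card * (Mg * wilsonSmoothLip N 4 β)) := by
  classical
  haveI : SecondCountableTopology (Matrix (Fin N) (Fin N) ℂ) :=
    inferInstanceAs (SecondCountableTopology (Fin N → Fin N → ℂ))
  haveI : SecondCountableTopology (Matrix.specialUnitaryGroup (Fin N) ℂ) :=
    Topology.IsEmbedding.subtypeVal.secondCountableTopology
  have hN0 : (0 : ℝ) < N := by exact_mod_cast (show 0 < N by omega)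
  have hv := continuous_wilsonPlaqWeight (N := N) β
  have hv0 := wilsonPlaqWeight_pos (N := N) β
  have hγ := isSpecification_torusWeightSpec (d := 4) (L := L) hv hv0
  have hG : IsGibbsMeasure (torusWeightSpec (d := 4) (L := L) (wilsonPlaqWeight N β))
      (wilsonMeasure (d := 4) (L := L) (fundamentalRep (Fin N)) β) := by
    rw [wilsonMeasure_eq_groupHeatKernelMeasure]; exact isGibbsMeasure_groupHeatKernelMeasure hv hv0
  set μ := wilsonMeasure (d := 4) (L := L) (fundamentalRep (Fin N)) β with hμdef
  haveI : IsProbabilityMeasure μ := hG.isProbabilityMeasure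
  set E : ℝ := wilsonSmoothLip N 4 β with hEdef
  -- the smoothed observables
  set fb := specAvg (torusWeightSpec (d := 4) (L := L) (wilsonPlaqWeight N β)) Δf f with hfb
  set gb := specAvg (torusWeightSpec (d := 4) (L := L) (wilsonPlaqWeight N β)) Δg g with hgb
  have hfbm : Measurable fb := measurable_specAvg hγ Δf hfm
  have hgbm : Measurable gb := measurable_specAvg hγ Δg hgm
  have hfbM : ∀ σ, |fb σ| ≤ Mf := abs_specAvg_le hγ Δf hMf
  have hgbM : ∀ σ, |gb σ| ≤ Mg := abs_specAvg_le hγ Δg hMg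
  have hfbdep : DependsOn fb (↑(plaqClosure Δf) : Set (Edge 4 L)) :=
    dependsOn_specAvg_torusWeightSpec hv Δf hfm hfdep
  have hgbdep : DependsOn gb (↑(plaqClosure Δg) : Set (Edge 4 L)) :=
    dependsOn_specAvg_torusWeightSpec hv Δg hgm hgdep
  have hvLip : ∀ (q : Plaquette 4 L) (y : Edge 4 L), y ∈ plaqEdgesT q →
      ∀ U U' : GaugeConfig 4 L (Matrix.specialUnitaryGroup (Fin N) ℂ), (∀ z, z ≠ y → U z = U' z) →
      |Real.log (wilsonPlaqWeight N β (plaquetteHolonomy U q.1 q.2.1.1 q.2.1.2)) -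
          Real.log (wilsonPlaqWeight N β (plaquetteHolonomy U' q.1 q.2.1.1 q.2.1.2))| ≤
        |β| * Real.sqrt N * suFrobDist (U y) (U' y) :=
    fun q y hy U U' hUU' => abs_log_wilsonPlaqWeight_hol_sub_le hL β q hy hUU'
  have hD : (0 : ℝ) < 2 * Real.sqrt N := by positivity
  have hfbLip : IsLipBound suFrobDist fb fun _ => Mf * E := by
    rw [hEdef, wilsonSmoothLip]
    exact isLipBound_specAvg_torusWeightSpec hv hv0 suFrobDist_nonneg hD suFrobDist_le
      (by positivity) hvLip Δf hfm hfdep hMf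
  have hgbLip : IsLipBound suFrobDist gb fun _ => Mg * E := by
    rw [hEdef, wilsonSmoothLip]
    exact isLipBound_specAvg_torusWeightSpec hv hv0 suFrobDist_nonneg hD suFrobDist_le
      (by positivity) hvLip Δg hgm hgdep hMg
  -- DLR identities: smoothing does not change the three integrals
  have h1 : ∫ σ, f σ * g σ ∂μ = ∫ σ, fb σ * gb σ ∂μ := by
    have ha : ∫ η, fb η * g η ∂μ = ∫ σ, f σ * g σ ∂μ :=
      integral_specAvg_mul hγ hG Δf hfm hMf hgm hMg hgdep fun x hx => hsep x (subset_plaqClosure Δf hx)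
    have hb : ∫ η, gb η * fb η ∂μ = ∫ σ, g σ * fb σ ∂μ :=
      integral_specAvg_mul hγ hG Δg hgm hMg hfbm hfbM hfbdep fun x hx hx' => hsep x hx' hx
    rw [← ha]
    have hb' : ∫ η, fb η * gb η ∂μ = ∫ σ, fb σ * g σ ∂μ := by
      simp_rw [mul_comm (fb _)]
      exact hb
    exact hb'.symm
  have h2 : ∫ σ, f σ ∂μ = ∫ σ, fb σ ∂μ := (integral_specAvg hγ hG Δf hfm hMf).symm
  have h3 : ∫ σ, g σ ∂μ = ∫ σ, gb σ ∂μ := (integral_specAvg hγ hG Δg hgm hMg).symm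
  rw [h1, h2, h3]
  -- the smoothed observables are admissible link observables on the plaquette closures
  have hE0 : 0 ≤ E := wilsonSmoothLip_nonneg hN 4 β
  have hMf0 : 0 ≤ Mf := (abs_nonneg _).trans (hMf fun _ => 1)
  have hMg0 : 0 ≤ Mg := (abs_nonneg _).trans (hMg fun _ => 1)
  have hfo : LinkObs suFrobDist fb (plaqClosure Δf) fun _ => Mf * E :=
    ⟨hfbm, ⟨Mf, hfbM⟩, hfbdep, fun _ => mul_nonneg hMf0 hE0, fun x σ τ h => hfbLip.le x σ τ h⟩
  have hgo : LinkObs suFrobDist gb (plaqClosure Δg) fun _ => Mg * E :=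
    ⟨hgbm, ⟨Mg, hgbM⟩, hgbdep, fun _ => mul_nonneg hMg0 hE0, fun x σ τ h => hgbLip.le x σ τ h⟩
  have hR2 : (0 : ℝ) ≤ 2 * Real.sqrt N := by positivity
  have key := star_abs_covariance_le hv hv0 hR2 suFrobDist_le hK hKloc hH1 hρ0 hρ1 hsum hfo hgo L₀ hL₀
  rw [← wilsonMeasure_eq_groupHeatKernelMeasure, ← hμdef] at key
  have hcov : cov[fb, gb; μ] = (∫ σ, fb σ * gb σ ∂μ) - (∫ σ, fb σ ∂μ) * ∫ σ, gb σ ∂μ := by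
    rw [covariance_eq_sub]
    · rfl
    · exact memLp_of_bounded (a := -Mf) (b := Mf) (ae_of_all _ fun σ => abs_le.1 (hfbM σ))
        hfbm.aestronglyMeasurable 2
    · exact memLp_of_bounded (a := -Mg) (b := Mg) (ae_of_all _ fun σ => abs_le.1 (hgbM σ))
        hgbm.aestronglyMeasurable 2
  rw [hcov] at key
  simp only [Finset.sum_const, nsmul_eq_mul] at key
  have e : (2 * ρ * ((2 * 4 : ℕ) : ℝ) + 1) = 16 * ρ + 1 := by push_cast; ring
  rw [e] at key
  rw [starRate]
  exact key

end Summit.Ventures.YMGap.StarSUNFront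

end
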